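import Mathlib
import HarnessLib
import Literature.Computability.Complexity.SymmetricCircuit
import Summits.PneNP.PneNP.Theorems.SymmetryBudgetWindowBarrierHeaderBricks

/-!
# `SymmetryBudget.WindowBarrier`, line `canonical-form-completeness` — stub S2 (header addressing)

Route `PneNP/SymmetryBudget`, crux `stmt-PneNP-2145`
(`Summit.PneNP.PneNP.Theses.SymmetryBudget.WindowBarrier`), line `canonical-form-completeness`.
**S2 (`stub_addressableBitLanguage`)**: given a string function `F ∈ FP` that is a complete
invariant for `Bud(m,⌊log₂ m⌋)`-isomorphism of the codes of `m`-vertex graphs (`m ≥ m₀`), there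
are `L ∈ P`, a header size `t` and a threshold `m₁` with (i) every `m`-slice of `L`
`Bud`-invariant, (ii) `t m + ⌊log₂ m⌋ ≤ m` for `m ≥ m₁`, (iii) for `m ≥ m₁` any two
header-agreeing matrices with non-`Bud`-isomorphic graphs separated by `L` after one common
overwrite of the header block — EXACTLY the registered signature of the skeleton
(`Summit.PneNP.PneNP.Theorems.stub_addressableBitLanguage`).

Proof (vocabulary and the `P`-half: `SymmetryBudgetWindowBarrierHeaderBricks.lean`):
`L = lang F A B m₁`, `t = hdr A B` with `A, B` from the output-length polynomial of `F`
(`exists_size_eval_le`: every position of `u = F (code)` is addressable by `A·|bin m| + B`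
bits) and `m₁ = max m₀ 2^R` (`exists_hdr_add_log_le`). (i): below `m₁` both sides are rejected;
above, `ρ ∈ Bud` fixes the header pointwise, so the query read off `Gr (x ∘ ρ×ρ)` is that of
`Gr x`, clearing commutes with `ρ × ρ`, and `F` is invariant on the cleared matrix
(`pFun_encode_rel`). (iii): clearing keeps a header-agreeing non-isomorphic pair non-isomorphic
(`gr_rel_eq_of_cleared`), so the two values of `F` differ (completeness), at a length or at a
bit (`exists_answer_ne`); that query, written into row `0` by `hdrOf`, is read back verbatim
while the cleared matrices — hence both `F`-values — are unchanged (`pFun_encode_ovw_hdrOf`).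

References: the line's skeleton; S. Arora, B. Barak, *Computational Complexity: A Modern
Approach*, CUP 2009, §1.3, §0.1 (padding and addressing are standard).
-/

-- `Summit.PneNP.PneNP.…` duplicates `PneNP` BY DESIGN (single-problem summit, D-0017).
set_option linter.dupNamespace false

namespace Summit.PneNP.PneNP.Theorems.AddressableBitLanguage

open Literature.Computability.Complexity _root_.Computability
open scoped Classical

variable {m : ℕ}

/-! ### The decision map on graph codes -/

section OnCodes

variable (F : List Bool → List Bool) (A B m₁ : ℕ)

/-- On a graph code the parser returns `(m, adjBits G)`. [folklore] -/
theorem pFun_encode (G : SimpleGraph (Fin m)) :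
    pFun F A B m₁ (encodingGraph.encode ⟨m, G⟩) = dec F A B m₁ (m, adjBits G) := by
  rw [encode_eq, pFun, Brick.fstF_boolPair, Brick.sndF_boolPair, bitsToNat_encodeNat]

/-- The decision on the code of `Gr z`, unfolded: the invariant `F` is evaluated on the code of the
CLEARED matrix. [folklore] -/
theorem dec_adjBits (z : Fin m × Fin m → Bool) :
    dec F A B m₁ (m, adjBits (Gr z)) =
      (!decide (m < m₁) && answer (qType (adjBits (Gr z))) (qAddr (aw A B m) (adjBits (Gr z)))
        (F (encodingGraph.encode ⟨m, Gr (ovw (hdr A B m) (fun _ => false) z)⟩))) := by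
  rw [encode_eq, ← clearStr_adjBits]
  rfl

/-- Below the threshold `m₁` the decision is `0`. [folklore] -/
theorem dec_of_lt {p : ℕ × List Bool} (h : p.1 < m₁) : dec F A B m₁ p = false := by
  simp [dec, h]

variable {F A B m₁}

/-- **Invariance of the slice**: for a relabelling fixing the header and an `F` invariant on the
cleared matrix, the decision is unchanged. [folklore] -/
theorem pFun_encode_rel {ρ : Equiv.Perm (Fin m)}
    (hfix : ∀ i : Fin m, (i : ℕ) < hdr A B m → ρ i = i) (htm : hdr A B m ≤ m)
    (x : Fin m × Fin m → Bool)
    (hF : F (encodingGraph.encode ⟨m, Gr (rel ρ (ovw (hdr A B m) (fun _ => false) x))⟩) =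
      F (encodingGraph.encode ⟨m, Gr (ovw (hdr A B m) (fun _ => false) x)⟩)) :
    pFun F A B m₁ (encodingGraph.encode ⟨m, Gr (rel ρ x)⟩) =
      pFun F A B m₁ (encodingGraph.encode ⟨m, Gr x⟩) := by
  rw [pFun_encode, pFun_encode, dec_adjBits, dec_adjBits, ovw_false_rel hfix, hF]
  have hmm : hdr A B m ≤ m * m := htm.trans (Nat.le_mul_self m)
  have h2 : 2 ≤ hdr A B m := Nat.le_add_left 2 _
  have hq : qType (adjBits (Gr (rel ρ x))) = qType (adjBits (Gr x)) := by
    simp only [qType]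
    rw [List.getD_eq_getElem _ _ (by simp; omega), List.getD_eq_getElem _ _ (by simp; omega)]
    exact adjBits_rel_getElem hfix htm x (by omega) _ _
  have ha : qAddrBits (aw A B m) (adjBits (Gr (rel ρ x))) =
      qAddrBits (aw A B m) (adjBits (Gr x)) := by
    apply List.ext_getElem
    · simp [qAddrBits]
    · intro j hj1 hj2
      simp only [qAddrBits, List.getElem_take, List.getElem_drop]
      have hj : j < aw A B m := by simp [qAddrBits] at hj1; omega
      exact adjBits_rel_getElem hfix htm x (by unfold hdr; omega) _ _
  rw [hq, qAddr, qAddr, ha]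

/-- **Reading a written query**: on the code of `Gr (ovw t (hdrOf Q) z)` the decision answers the
query `(Q 1, ⟦Q 2 … Q (t-1)⟧)` on `F` of the code of the cleared matrix. [folklore] -/
theorem pFun_encode_ovw_hdrOf (hm : m₁ ≤ m) (htm : hdr A B m ≤ m) (Q : ℕ → Bool)
    (z : Fin m × Fin m → Bool) :
    pFun F A B m₁ (encodingGraph.encode ⟨m, Gr (ovw (hdr A B m) (hdrOf Q) z)⟩) =
      answer (Q 1) (bitsToNat (List.ofFn fun j : Fin (aw A B m) => Q (2 + j)))
        (F (encodingGraph.encode ⟨m, Gr (ovw (hdr A B m) (fun _ => false) z)⟩)) := by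
  rw [pFun_encode, dec_adjBits, ovw_false_ovw, decide_eq_false (not_lt.2 hm), Bool.not_false,
    Bool.true_and]
  have hmm : hdr A B m ≤ m * m := htm.trans (Nat.le_mul_self m)
  have h2 : 2 ≤ hdr A B m := Nat.le_add_left 2 _
  have hq : qType (adjBits (Gr (ovw (hdr A B m) (hdrOf Q) z))) = Q 1 := by
    simp only [qType]
    rw [List.getD_eq_getElem _ _ (by simp; omega)]
    exact adjBits_ovw_hdrOf_getElem htm Q z Nat.one_pos (by omega) _
  have ha : qAddrBits (aw A B m) (adjBits (Gr (ovw (hdr A B m) (hdrOf Q) z))) =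
      List.ofFn fun j : Fin (aw A B m) => Q (2 + j) := by
    apply List.ext_getElem
    · simp [qAddrBits, hdr] at hmm ⊢
      omega
    · intro j hj1 hj2
      simp only [qAddrBits, List.getElem_take, List.getElem_drop, List.getElem_ofFn]
      have hj : j < aw A B m := by simpa using hj2
      exact adjBits_ovw_hdrOf_getElem htm Q z (by omega) (by unfold hdr; omega) _
  rw [hq, qAddr, ha]

end OnCodes

/-! ### Separating two distinct strings by one query -/

/-- Two distinct strings are separated by one query of address at most the longer length: equal
lengths — a differing bit (type `1`); different lengths — the shorter length (type `0`).
[folklore] -/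
theorem exists_answer_ne {u₁ u₂ : List Bool} (h : u₁ ≠ u₂) :
    ∃ ty : Bool, ∃ a : ℕ, a ≤ max u₁.length u₂.length ∧ answer ty a u₁ ≠ answer ty a u₂ := by
  by_cases hlen : u₁.length = u₂.length
  · have hex : ∃ i, ∃ hi : i < u₁.length, u₁[i] ≠ u₂[i]'(hlen ▸ hi) := by
      by_contra hall
      push Not at hall
      exact h (List.ext_getElem hlen fun i h1 _ => hall i h1)
    obtain ⟨i, hi, hne⟩ := hex
    have hi2 : i < u₂.length := hlen ▸ hi
    refine ⟨true, i, by omega, ?_⟩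
    simpa [answer, hi, hi2, List.getD_eq_getElem _ _ hi, List.getD_eq_getElem _ _ hi2] using hne
  · refine ⟨false, min u₁.length u₂.length, by omega, ?_⟩
    rcases Nat.lt_or_gt_of_ne hlen with hlt | hlt
    · simp [answer, hlt, hlt.le]
    · simp [answer, hlt, hlt.le]

/-! ### Arithmetic of the header size -/

/-- Linear functions are eventually below `2^r`. [folklore] -/
theorem exists_linear_le_two_pow (c K : ℕ) : ∃ R, ∀ r, R ≤ r → c * r + K ≤ 2 ^ r := by
  have hsq : ∀ r, 4 ≤ r → r * r ≤ 2 ^ r := by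
    intro r hr
    induction r, hr using Nat.le_induction with
    | base => norm_num
    | succ n hn ih =>
      have h3 : 2 * n + 1 ≤ n * n := by nlinarith
      calc (n + 1) * (n + 1) = n * n + (2 * n + 1) := by ring
        _ ≤ 2 ^ n + 2 ^ n := Nat.add_le_add ih (h3.trans ih)
        _ = 2 ^ (n + 1) := by ring
  refine ⟨max 4 (c + K), fun r hr => ?_⟩
  have h4 : 4 ≤ r := le_of_max_le_left hr
  have hcK : c + K ≤ r := le_of_max_le_right hr
  calc c * r + K ≤ c * r + K * r := by nlinarith
    _ = (c + K) * r := by ring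
    _ ≤ r * r := Nat.mul_le_mul_right r hcK
    _ ≤ 2 ^ r := hsq r h4

/-- **The header fits**: eventually `A·|bin m| + B + 2 + ⌊log₂ m⌋ ≤ m`. [folklore] -/
theorem exists_hdr_add_log_le (A B : ℕ) :
    ∃ R, ∀ m, 2 ^ R ≤ m → hdr A B m + Nat.log 2 m ≤ m := by
  obtain ⟨R, hR⟩ := exists_linear_le_two_pow (A + 1) (A + B + 3)
  refine ⟨R, fun m hm => ?_⟩
  have hm0 : m ≠ 0 := by have := Nat.one_le_two_pow (n := R); omega
  have hsz : R < Nat.size m := Nat.lt_size.2 hm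
  have hlog : Nat.log 2 m < Nat.size m := Nat.lt_size.2 (Nat.pow_log_le_self 2 hm0)
  have hpow : 2 ^ (Nat.size m - 1) ≤ m := Nat.lt_size.1 (by omega)
  have hlin := hR (Nat.size m - 1) (by omega)
  have hlen : (encodeNat m).length = Nat.size m := CodeFP.length_natE m
  unfold hdr aw
  rw [hlen]
  have e1 : (A + 1) * (Nat.size m - 1) = (A + 1) * Nat.size m - (A + 1) := Nat.mul_sub_one _ _
  have e2 : (A + 1) * Nat.size m = A * Nat.size m + Nat.size m := by ring
  omega

/-- **Addresses fit**: the size of a polynomial in the code length `2|bin m| + 2 + m²` is linear in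
`|bin m|`. [folklore] -/
theorem exists_size_eval_le (P : Polynomial ℕ) :
    ∃ A B, ∀ m, Nat.size (P.eval (2 * Nat.size m + 2 + m * m)) ≤ A * Nat.size m + B := by
  obtain ⟨c, k, hck⟩ := exists_eval_le_mul_pow_add P
  refine ⟨2 * k, 3 * k + Nat.size c + 2, fun m => ?_⟩
  set s := Nat.size m with hs
  set n := 2 * s + 2 + m * m with hn'
  have hself : ∀ x, Nat.size x ≤ x := fun x => Nat.size_le.2 x.lt_two_pow_self
  have hn : Nat.size n ≤ 2 * s + 3 := by
    refine (CodeFP.size_add_le _ _).trans ?_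
    have h1 : Nat.size (2 * s + 2) ≤ 2 * s + 2 := hself _
    have h2 : Nat.size (m * m) ≤ s + s := CodeFP.size_mul_le m m
    omega
  have hkn : k * Nat.size n ≤ k * (2 * s + 3) := Nat.mul_le_mul_left k hn
  calc Nat.size (P.eval n)
      ≤ Nat.size (c * n ^ k + c) := CodeFP.size_mono (hck _)
    _ ≤ max (Nat.size (c * n ^ k)) (Nat.size c) + 1 := CodeFP.size_add_le _ _
    _ ≤ (Nat.size c + Nat.size (n ^ k)) + 1 := by
        have := CodeFP.size_mul_le c (n ^ k)
        omega
    _ ≤ (Nat.size c + (k * Nat.size n + 1)) + 1 := by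
        have := CodeFP.size_pow_le n k
        omega
    _ ≤ 2 * k * s + (3 * k + Nat.size c + 2) := by nlinarith

/-! ### The stub -/

/-- A padded numeral `bin a ++ 0^{n - |bin a|}` has value `a`. [folklore] -/
theorem bitsToNat_pad (a n : ℕ) :
    bitsToNat (encodeNat a ++ List.replicate (n - (encodeNat a).length) false) = a := by
  rw [bitsToNat_append, bitsToNat_replicate_false, bitsToNat_encodeNat]; simp

end Summit.PneNP.PneNP.Theorems.AddressableBitLanguage

namespace Summit.PneNP.PneNP.Theorems

open Literature.Computability.Complexity _root_.Computability Filter AddressableBitLanguage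
open scoped Classical

/-- **S2 — header addressing** (line `canonical-form-completeness` of crux
`SymmetryBudget.WindowBarrier`, stmt-PneNP-2145): a complete invariant `F ∈ FP` for
`Bud(m,⌊log₂ m⌋)`-isomorphism of graph codes yields ONE bit language `L ∈ P` whose `m`-slices are
`Bud`-invariant for all `m`, with a header of size `t m = O(log m)` fitting below the free part
(`t m + ⌊log₂ m⌋ ≤ m`), and which separates every header-agreeing non-`Bud`-isomorphic pair after
a common overwrite of the header block.
Witness: `L = {w | pFun F A B m₁ w = 1}` — parse `w = ⟨bin m, bits⟩`, reject `m < m₁`, read the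
query `(bits[1], ⟦bits[2 … t-1]⟧)` off row `0`, clear the header block, apply `F`, answer
`a < |u|` (type `0`) or `a < |u| ∧ u[a]` (type `1`). [folklore] -/
theorem stub_addressableBitLanguage :
    ∀ F ∈ FP, ∀ m₀ : ℕ,
      (∀ m : ℕ, m₀ ≤ m → ∀ x y : Fin m × Fin m → Bool,
        (F (encodingGraph.encode ⟨m, SimpleGraph.fromRel fun u v => x (u, v) = true⟩) =
            F (encodingGraph.encode ⟨m, SimpleGraph.fromRel fun u v => y (u, v) = true⟩) ↔
          ∃ ρ ∈ pointStabiliserBudget m (Nat.log 2 m),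
            (SimpleGraph.fromRel fun u v => x (ρ u, ρ v) = true) =
              (SimpleGraph.fromRel fun u v => y (u, v) = true))) →
      ∃ L ∈ Classes.P, ∃ t : ℕ → ℕ, ∃ m₁ : ℕ,
        (∀ m : ℕ, ∀ ρ ∈ pointStabiliserBudget m (Nat.log 2 m), ∀ x : Fin m × Fin m → Bool,
          encodingGraph.encode ⟨m, SimpleGraph.fromRel fun u v => x (ρ u, ρ v) = true⟩ ∈ L ↔
            encodingGraph.encode ⟨m, SimpleGraph.fromRel fun u v => x (u, v) = true⟩ ∈ L) ∧
        (∀ m : ℕ, m₁ ≤ m → t m + Nat.log 2 m ≤ m) ∧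
        (∀ m : ℕ, m₁ ≤ m → ∀ x y : Fin m × Fin m → Bool,
          (∀ q : Fin m × Fin m, (q.1 : ℕ) < t m → (q.2 : ℕ) < t m → x q = y q) →
          (¬ ∃ ρ ∈ pointStabiliserBudget m (Nat.log 2 m),
              (SimpleGraph.fromRel fun u v => x (ρ u, ρ v) = true) =
                (SimpleGraph.fromRel fun u v => y (u, v) = true)) →
          ∃ h : Fin m × Fin m → Bool,
            ¬ (encodingGraph.encode ⟨m, SimpleGraph.fromRel fun u v =>
                    (if (u : ℕ) < t m ∧ (v : ℕ) < t m then h (u, v) else x (u, v)) = true⟩ ∈ L ↔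
                encodingGraph.encode ⟨m, SimpleGraph.fromRel fun u v =>
                    (if (u : ℕ) < t m ∧ (v : ℕ) < t m then h (u, v) else y (u, v)) = true⟩ ∈ L)) := by
  intro F hF m₀ hcomp
  -- the hypothesis over the named vocabulary
  have hcomp' : ∀ m : ℕ, m₀ ≤ m → ∀ x y : Fin m × Fin m → Bool,
      (F (encodingGraph.encode ⟨m, Gr x⟩) = F (encodingGraph.encode ⟨m, Gr y⟩) ↔
        ∃ ρ ∈ pointStabiliserBudget m (Nat.log 2 m), Gr (rel ρ x) = Gr y) := hcomp
  -- the constants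
  obtain ⟨P, hP⟩ := exists_poly_length_le_of_mem_FP hF
  obtain ⟨A, B, hAB⟩ := exists_size_eval_le P
  obtain ⟨R, hR⟩ := exists_hdr_add_log_le A B
  set m₁ : ℕ := max m₀ (2 ^ R) with hm₁
  have hfit : ∀ m, m₁ ≤ m → hdr A B m + Nat.log 2 m ≤ m := fun m hm =>
    hR m (le_of_max_le_right hm)
  have hfix : ∀ m, m₁ ≤ m → ∀ ρ ∈ pointStabiliserBudget m (Nat.log 2 m), ∀ i : Fin m,
      (i : ℕ) < hdr A B m → ρ i = i := fun m hm ρ hρ i hi =>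
    hρ i (by have := hfit m hm; omega)
  refine ⟨lang F A B m₁, lang_mem_P hF A B m₁, hdr A B, m₁, ?_, hfit, ?_⟩
  · -- (i) invariance of every slice
    intro m ρ hρ x
    change pFun F A B m₁ (encodingGraph.encode ⟨m, Gr (rel ρ x)⟩) = true ↔
      pFun F A B m₁ (encodingGraph.encode ⟨m, Gr x⟩) = true
    by_cases hm : m₁ ≤ m
    · have htm : hdr A B m ≤ m := by have := hfit m hm; omega
      have hm₀ : m₀ ≤ m := le_of_max_le_left hm
      rw [pFun_encode_rel (hfix m hm ρ hρ) htm x]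
      exact ((hcomp' m hm₀ _ _).2 ⟨ρ, hρ, rfl⟩).symm
    · rw [pFun_encode, pFun_encode, dec_of_lt F A B m₁ (not_le.1 hm),
        dec_of_lt F A B m₁ (not_le.1 hm)]
  · -- (iii) separation after a common header overwrite
    intro m hm x y hagree hniso
    have hm₀ : m₀ ≤ m := le_of_max_le_left hm
    have htm : hdr A B m ≤ m := by have := hfit m hm; omega
    set x₀ := ovw (hdr A B m) (fun _ => false) x with hx₀
    set y₀ := ovw (hdr A B m) (fun _ => false) y with hy₀
    have hniso₀ :
        ¬ ∃ ρ ∈ pointStabiliserBudget m (Nat.log 2 m), Gr (rel ρ x₀) = Gr y₀ := by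
      rintro ⟨ρ, hρ, h⟩
      exact hniso ⟨ρ, hρ, gr_rel_eq_of_cleared (hfix m hm ρ hρ) x y hagree h⟩
    have hne : F (encodingGraph.encode ⟨m, Gr x₀⟩) ≠ F (encodingGraph.encode ⟨m, Gr y₀⟩) :=
      fun heq => hniso₀ ((hcomp' m hm₀ x₀ y₀).1 heq)
    obtain ⟨ty, a, ha, hsep⟩ := exists_answer_ne hne
    -- the address fits into the address field
    have hlenF : ∀ z : Fin m × Fin m → Bool, (F (encodingGraph.encode ⟨m, Gr z⟩)).length ≤
        P.eval (2 * Nat.size m + 2 + m * m) := fun z => by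
      refine (hP _).trans (le_of_eq ?_)
      rw [encode_eq, length_boolPair, length_adjBits, CodeFP.length_natE]
    have hsize : (encodeNat a).length ≤ aw A B m := by
      rw [CodeFP.length_natE, aw, CodeFP.length_natE]
      refine (CodeFP.size_mono (ha.trans (max_le (hlenF x₀) (hlenF y₀)))).trans (hAB m)
    set pad := encodeNat a ++ List.replicate (aw A B m - (encodeNat a).length) false with hpad
    have hpadlen : pad.length = aw A B m := by
      rw [hpad, List.length_append, List.length_replicate]; omega
    set Q : ℕ → Bool := fun k => if k = 1 then ty else pad.getD (k - 2) false with hQ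
    have hQ1 : Q 1 = ty := by simp [hQ]
    have hQa : (List.ofFn fun j : Fin (aw A B m) => Q (2 + j)) = pad := by
      apply List.ext_getElem
      · simp [hpadlen]
      · intro j h1 h2
        rw [List.getElem_ofFn]
        simp only [hQ, show (2 + j : ℕ) ≠ 1 by omega, if_false, Nat.add_sub_cancel_left]
        exact List.getD_eq_getElem _ _ h2
    refine ⟨hdrOf Q, ?_⟩
    change
      ¬ (pFun F A B m₁ (encodingGraph.encode ⟨m, Gr (ovw (hdr A B m) (hdrOf Q) x)⟩) = true ↔
        pFun F A B m₁ (encodingGraph.encode ⟨m, Gr (ovw (hdr A B m) (hdrOf Q) y)⟩) = true)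
    rw [pFun_encode_ovw_hdrOf hm htm Q x, pFun_encode_ovw_hdrOf hm htm Q y, hQ1, hQa, hpad,
      bitsToNat_pad]
    intro hiff
    exact hsep (Bool.eq_iff_iff.2 hiff)

end Summit.PneNP.PneNP.Theorems
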